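import Summits.ValiantsHypothesis.ValiantsHypothesis.Theorems.NewtonUnitEquationsTwoProductsFullDepthFactorisation
import Summits.ValiantsHypothesis.ValiantsHypothesis.Theorems.NewtonUnitEquationsTwoProductsSubmergedTruncation
import Summits.ValiantsHypothesis.ValiantsHypothesis.Theorems.NewtonUnitEquationsTwoProductsFormalLogLinearisationStubLogLinearisation

/-!
# Micro-rung `lagrange-codepth` — L2: THE FULL-DEPTH CELL LAW (at co-depth 0 every cell family has at most ONE point, any alphabet)

`fullDepthCellLaw_holds : FullDepthCellLaw` (val-idea-36 g2's L2, text in `…FullDepthDefs`).  Proof: by L1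
(`fullDepthFactorisation_holds`) `∏(1+u_j) − ∏(1+v_j) = ∏_j f_j` with `f_j := u_j − v_i` (`i` fixed), each `f_j` supported on the tail
support `T`.  For a cell with letter order `R`, let `A_j ⊆ supp f_j` be the `R`-MAXIMAL letters of `f_j` and `g_j` the restriction of `f_j`
to `A_j` — objects defined from `R` alone, hence the SAME for every witness of the cell.  At any witness `ξ` (valid, inducing `R` on `T`),
`A_j` is the top `ξ`-layer of `supp f_j`, so `∏ f_j − ∏ g_j` lies strictly below the level `W = Σ_j w_j` while `∏ g_j ≠ 0` (domain) is
homogeneous of level `W`; hence a strict `ξ`-top `l` of `supp ∏ f_j` forces `supp ∏ g_j = {l}` (`support_prod_eq_singleton_of_isStrictTop`).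
Two points of the cell family therefore both equal the unique support point of the witness-independent polynomial `∏ g_j`.  (Log-support ↔
support of `tailDiff` by the landed `stub_logLinearisation`.)  Helper mode (`--supports stmt-ValiantsHypothesis-5906 --as helper`).
Honest framing: a micro-rung (co-depth `0` slice of the per-cell law; `CoDepthLaw` for `c ≥ 1` was KILLED by crit-8 #9 and is NOT claimed);
nothing here closes 5906 (`TwoProducts` / `ResidualLawV23` / `PlanarCellBound` OPEN); VP ≠ VNP is NOT proved.  No instances, no notation,
no named facts. [folklore]
-/

noncomputable section
set_option linter.dupNamespace false

namespace Summit.ValiantsHypothesis.ValiantsHypothesis.Theorems.NewtonUnitEquations.TwoProducts.FullDepth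
open scoped BigOperators
open MvPolynomial
open Summit.ValiantsHypothesis.ValiantsHypothesis.Theorems.NewtonUnitEquations.TwoProducts.FormalLogLinearisation
open Summit.ValiantsHypothesis.ValiantsHypothesis.Theorems.NewtonUnitEquations.TwoProducts.PlanarCell
open Summit.ValiantsHypothesis.ValiantsHypothesis.Theorems.NewtonUnitEquations.TwoProducts.Submerged

variable {m : ℕ}

/-! ## Levels: strict variants of the `Below` calculus of `…SubmergedBandStep` / `…SubmergedTruncation` -/

/-- A product of a polynomial at level `≤ a` and one strictly below level `b` lies strictly below `a + b`. [folklore] -/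
theorem lt_of_mem_support_mul {ξ : Fin 2 → ℝ} {a b : ℝ} {P Q : MvPolynomial (Fin 2) ℂ} (hP : Below ξ a P)
    (hQ : ∀ x ∈ Q.support, wt ξ x < b) : ∀ x ∈ (P * Q).support, wt ξ x < a + b := by
  classical
  intro x hx
  obtain ⟨p, hp, q, hq, rfl⟩ := Finset.mem_add.1 (support_mul P Q hx)
  rw [wt_add]
  exact add_lt_add_of_le_of_lt (hP p hp) (hQ q hq)

/-- A sum of two polynomials strictly below a level lies strictly below it. [folklore] -/
theorem lt_of_mem_support_add {ξ : Fin 2 → ℝ} {w : ℝ} {P Q : MvPolynomial (Fin 2) ℂ} (hP : ∀ x ∈ P.support, wt ξ x < w)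
    (hQ : ∀ x ∈ Q.support, wt ξ x < w) : ∀ x ∈ (P + Q).support, wt ξ x < w := by
  intro x hx
  rcases Finset.mem_union.1 (support_add hx) with h | h
  · exact hP x h
  · exact hQ x h

/-- A product of polynomials at levels `≤ w_j` lies at level `≤ Σ w_j`. [folklore] -/
theorem below_prod_sum {ι : Type*} (ξ : Fin 2 → ℝ) (s : Finset ι) (f : ι → MvPolynomial (Fin 2) ℂ) (w : ι → ℝ)
    (hf : ∀ j ∈ s, Below ξ (w j) (f j)) : Below ξ (∑ j ∈ s, w j) (∏ j ∈ s, f j) := by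
  classical
  induction s using Finset.induction_on with
  | empty => simpa using below_one ξ
  | insert a s ha ih =>
    rw [Finset.prod_insert ha, Finset.sum_insert ha]
    exact (hf a (Finset.mem_insert_self a s)).mul (ih fun j hj => hf j (Finset.mem_insert_of_mem hj))

/-- **Top layers multiply.**  If `g_j` lies at level `≤ w_j` and `f_j − g_j` strictly below `w_j` for every `j ∈ s`, then
`∏ f_j − ∏ g_j` lies strictly below `Σ w_j`. [folklore] -/
theorem prod_sub_prod_lt {ι : Type*} (ξ : Fin 2 → ℝ) (s : Finset ι) (f g : ι → MvPolynomial (Fin 2) ℂ) (w : ι → ℝ)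
    (hg : ∀ j ∈ s, Below ξ (w j) (g j)) (hfg : ∀ j ∈ s, ∀ x ∈ (f j - g j).support, wt ξ x < w j) :
    ∀ x ∈ (∏ j ∈ s, f j - ∏ j ∈ s, g j).support, wt ξ x < ∑ j ∈ s, w j := by
  classical
  induction s using Finset.induction_on with
  | empty => intro x hx; simp at hx
  | insert a s ha ih =>
    have hf : ∀ j ∈ s, Below ξ (w j) (f j) := fun j hj => by
      have h : f j = g j + (f j - g j) := by ring
      rw [h]
      exact (hg j (Finset.mem_insert_of_mem hj)).add fun x hx => (hfg j (Finset.mem_insert_of_mem hj) x hx).le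
    have hF : Below ξ (∑ j ∈ s, w j) (∏ j ∈ s, f j) := below_prod_sum ξ s f w hf
    rw [Finset.prod_insert ha, Finset.prod_insert ha, Finset.sum_insert ha]
    have key : f a * ∏ j ∈ s, f j - g a * ∏ j ∈ s, g j =
        (f a - g a) * ∏ j ∈ s, f j + g a * (∏ j ∈ s, f j - ∏ j ∈ s, g j) := by ring
    rw [key]
    refine lt_of_mem_support_add (fun x hx => ?_) (fun x hx => ?_)
    · have h := lt_of_mem_support_mul hF (hfg a (Finset.mem_insert_self a s))
      rw [mul_comm] at hx
      have := h x hx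
      linarith
    · exact lt_of_mem_support_mul (hg a (Finset.mem_insert_self a s))
        (ih (fun j hj => hg j (Finset.mem_insert_of_mem hj)) fun j hj => hfg j (Finset.mem_insert_of_mem hj)) x hx

/-- **A strict top pins the top layer.**  If `F − G` lies strictly below the level `W`, `G ≠ 0` is homogeneous of level `W`, and `l` is a
strict `ξ`-top of `supp F`, then `supp G = {l}`. [folklore] -/
theorem support_eq_singleton_of_isStrictTop (ξ : Fin 2 → ℝ) (F G : MvPolynomial (Fin 2) ℂ) (W : ℝ)
    (hFG : ∀ x ∈ (F - G).support, wt ξ x < W) (hG : ∀ x ∈ G.support, wt ξ x = W) (hG0 : G ≠ 0)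
    (l : Expo) (hl : IsStrictTop ξ (↑F.support) l) : G.support = {l} := by
  classical
  have hcoe : ∀ x, wt ξ x = W → coeff x F = coeff x G := by
    intro x hx
    by_contra hne
    have hmem : x ∈ (F - G).support := by
      rw [mem_support_iff, coeff_sub]
      exact sub_ne_zero.2 hne
    have := hFG x hmem
    rw [hx] at this
    exact lt_irrefl W this
  have hFle : ∀ x ∈ F.support, wt ξ x ≤ W := by
    intro x hx
    have h : F = G + (F - G) := by ring
    rw [h] at hx
    rcases Finset.mem_union.1 (support_add hx) with h1 | h1
    · exact (hG x h1).le
    · exact (hFG x h1).le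
  have hsub : ∀ x ∈ G.support, x = l := by
    intro x hx
    have hxF : x ∈ F.support := by
      rw [mem_support_iff, hcoe x (hG x hx)]
      exact mem_support_iff.1 hx
    by_contra hne
    have h1 := hl.2 x (Finset.mem_coe.2 hxF) hne
    have h2 := hFle l hl.1
    rw [hG x hx] at h1
    linarith
  have hGne : G.support.Nonempty := Finset.nonempty_of_ne_empty fun h => hG0 (support_eq_empty.1 h)
  obtain ⟨x₀, hx₀⟩ := hGne
  ext x
  simp only [Finset.mem_singleton]
  constructor
  · exact hsub x
  · rintro rfl
    rw [← hsub x₀ hx₀]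
    exact hx₀

/-- **L2 — THE FULL-DEPTH CELL LAW** (`FullDepthCellLaw`, val-idea-36 g2's text verbatim in `…FullDepthDefs`): at full depth every cell
family has at most one point, for ANY alphabet (relations, towers, shared letters allowed). [folklore] -/
theorem fullDepthCellLaw_holds : FullDepthCellLaw := by
  intro m u v hu0 hv0 hfd R S hS
  classical
  refine Finset.card_le_one.2 fun l hl l' hl' => ?_
  obtain ⟨ξ, hξ, htop, hR⟩ := hS l hl
  obtain ⟨ξ', hξ', htop', hR'⟩ := hS l' hl'
  have hF : IsStrictTop ξ (↑(tailDiff u v).support) l := (stub_logLinearisation m u v hu0 hv0 ξ hξ l).2 htop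
  have hF' : IsStrictTop ξ' (↑(tailDiff u v).support) l' := (stub_logLinearisation m u v hu0 hv0 ξ' hξ' l').2 htop'
  -- `m = 0` is impossible (`tailDiff = 0` has no strict top)
  rcases Nat.eq_zero_or_pos m with hm | hm
  · subst hm
    exfalso
    have h0 : tailDiff u v = 0 := by simp [tailDiff]
    have h1 := hF.1
    rw [h0, support_zero] at h1
    simp at h1
  let i : Fin m := ⟨0, hm⟩
  -- the factorisation `tailDiff = ∏_j f_j`, `f_j = u_j − v_i`
  let f : Fin m → MvPolynomial (Fin 2) ℂ := fun j => u j - v i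
  have hfact : tailDiff u v = ∏ j, f j := fullDepthFactorisation_holds m u v hfd i
  have hfT : ∀ j, (f j).support ⊆ tailSupport u v := by
    intro j x hx
    have hx' : x ∈ (u j - v i).support := hx
    rcases Finset.mem_union.1 (support_sub _ (u j) (v i) hx') with h | h
    · exact Finset.mem_union_left _ (Finset.mem_biUnion.2 ⟨j, Finset.mem_univ _, h⟩)
    · exact Finset.mem_union_right _ (Finset.mem_biUnion.2 ⟨i, Finset.mem_univ _, h⟩)
  have hf0 : ∀ j, f j ≠ 0 := by
    intro j hj
    have h0 : tailDiff u v = 0 := by rw [hfact]; exact Finset.prod_eq_zero (Finset.mem_univ j) hj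
    have h1 := hF.1
    rw [h0, support_zero] at h1
    simp at h1
  -- the `R`-maximal layers and the restricted factors (witness-independent!)
  let A : Fin m → Finset Expo := fun j => (f j).support.filter (fun x => ∀ y ∈ (f j).support, R y x)
  let g : Fin m → MvPolynomial (Fin 2) ℂ := fun j => ∑ x ∈ A j, monomial x (coeff x (f j))
  have hgcoeff : ∀ j x, coeff x (g j) = if x ∈ A j then coeff x (f j) else 0 := fun j x =>
    coeff_sum_monomial (f j) (A j) x
  have hgsupp : ∀ j, (g j).support = A j := by
    intro j
    ext x
    rw [mem_support_iff, hgcoeff]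
    constructor
    · intro h
      by_contra hx
      exact h (if_neg hx)
    · intro hx
      rw [if_pos hx]
      exact mem_support_iff.1 (Finset.mem_filter.1 hx).1
  -- KEY: at ANY witness of the cell, `supp (∏ g) = {the strict top}`
  have key : ∀ (ζ : Fin 2 → ℝ) (x : Expo),
      (∀ e ∈ tailSupport u v, ∀ e' ∈ tailSupport u v, (R e e' ↔ wt ζ e ≤ wt ζ e')) →
      IsStrictTop ζ (↑(tailDiff u v).support) x → (∏ j, g j).support = {x} := by
    intro ζ x hRζ hx
    have hAne : ∀ j, (A j).Nonempty := by
      intro j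
      obtain ⟨y, hy, hmax⟩ := Finset.exists_max_image (f j).support (wt ζ)
        (Finset.nonempty_of_ne_empty fun h => hf0 j (support_eq_empty.1 h))
      exact ⟨y, Finset.mem_filter.2 ⟨hy, fun z hz => (hRζ z (hfT j hz) y (hfT j hy)).2 (hmax z hz)⟩⟩
    choose y hy using hAne
    have hAw : ∀ j, ∀ x ∈ A j, wt ζ x = wt ζ (y j) := by
      intro j x hx
      have hxs := Finset.mem_filter.1 hx
      have hys := Finset.mem_filter.1 (hy j)
      have h1 : R (y j) x := hxs.2 (y j) hys.1
      have h2 : R x (y j) := hys.2 x hxs.1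
      exact le_antisymm ((hRζ _ (hfT j hxs.1) _ (hfT j hys.1)).1 h2) ((hRζ _ (hfT j hys.1) _ (hfT j hxs.1)).1 h1)
    have hlow : ∀ j, ∀ x ∈ (f j).support, x ∉ A j → wt ζ x < wt ζ (y j) := by
      intro j x hx hxA
      have h : ¬ ∀ z ∈ (f j).support, R z x := fun h => hxA (Finset.mem_filter.2 ⟨hx, h⟩)
      push Not at h
      obtain ⟨z, hz, hzx⟩ := h
      have hlt : wt ζ x < wt ζ z := by
        by_contra hle
        push Not at hle
        exact hzx ((hRζ z (hfT j hz) x (hfT j hx)).2 hle)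
      have hys := Finset.mem_filter.1 (hy j)
      have hzle : wt ζ z ≤ wt ζ (y j) := (hRζ z (hfT j hz) (y j) (hfT j hys.1)).1 (hys.2 z hz)
      linarith
    have hgB : ∀ j ∈ (Finset.univ : Finset (Fin m)), Below ζ (wt ζ (y j)) (g j) := fun j _ x hx =>
      (hAw j x (by rwa [hgsupp] at hx)).le
    have hfg : ∀ j ∈ (Finset.univ : Finset (Fin m)), ∀ x ∈ (f j - g j).support, wt ζ x < wt ζ (y j) := by
      intro j _ x hx
      have hne : coeff x (f j - g j) ≠ 0 := mem_support_iff.1 hx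
      rw [coeff_sub, hgcoeff] at hne
      by_cases hxA : x ∈ A j
      · rw [if_pos hxA, sub_self] at hne
        exact absurd rfl hne
      · rw [if_neg hxA, sub_zero] at hne
        exact hlow j x (mem_support_iff.2 hne) hxA
    have hdiff := prod_sub_prod_lt ζ Finset.univ f g (fun j => wt ζ (y j)) hgB hfg
    have hGne : (∏ j, g j) ≠ 0 := Finset.prod_ne_zero_iff.2 fun j _ => by
      rw [Ne, ← support_eq_empty, hgsupp]
      exact Finset.ne_empty_of_mem (hy j)
    have hGW : ∀ s : Finset (Fin m), ∀ x ∈ (∏ j ∈ s, g j).support, wt ζ x = ∑ j ∈ s, wt ζ (y j) := by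
      intro s
      induction s using Finset.induction_on with
      | empty =>
        intro x hx
        simp only [Finset.prod_empty] at hx
        have hx0 : x = 0 := by
          have h := support_one (R := ℂ) (σ := Fin 2) ▸ hx
          simpa using h
        rw [hx0, wt_zero, Finset.sum_empty]
      | insert a s ha ih =>
        intro x hx
        rw [Finset.prod_insert ha] at hx
        obtain ⟨p, hp, q, hq, rfl⟩ := Finset.mem_add.1 (support_mul _ _ hx)
        rw [wt_add, Finset.sum_insert ha, hAw a p (by rwa [hgsupp] at hp), ih q hq]
    rw [hfact] at hx
    exact support_eq_singleton_of_isStrictTop ζ (∏ j, f j) (∏ j, g j) (∑ j, wt ζ (y j)) hdiff (hGW Finset.univ) hGne x hx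
  have h1 := key ξ l hR hF
  have h2 := key ξ' l' hR' hF'
  exact Finset.singleton_injective (h1.symm.trans h2)

end Summit.ValiantsHypothesis.ValiantsHypothesis.Theorems.NewtonUnitEquations.TwoProducts.FullDepth

end
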